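import Literature.Computability.AlgebraicComplexity.PartitionedTensors
import HarnessLib

/-!
# Independent sub-tensors: a tensor whose parts are assigned to unique summands is the direct sum
of the summand sub-tensors (Vassilevska Williams–Xu–Xu–Zhou 2024, §3.1 and §5.5, eq. "𝒯''' = ⊕ 𝒯'''|_{X_I Y_J Z_K}")

Topic `Literature/Computability/AlgebraicComplexity`.  The step of every laser-method analysis at
which the zeroed-out power becomes a DIRECT SUM: Vassilevska Williams–Xu–Xu–Zhou, *New bounds for
matrix multiplication: from alpha to omega* (SODA 2024, arXiv:2307.07970), §3.1 —

> If `T` and `T'` are supported on disjoint variable sets, their sum is the same as their direct sum,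
> in which case we say `T` and `T'` are independent,

— and §5.5 (likewise §6.5), after the compatibility / unique-triple / usefulness zero-outs:

> for different remaining block triples `X_I Y_J Z_K`, `𝒯'''|_{X_I Y_J Z_K}` are level-1-independent,
> i.e., they do not share the same level-1 blocks … every remaining `Z_K̂` in `𝒯'''` is contained in a
> unique level-`ℓ` triple as well. As a result, we can write `𝒯''' = ⊕_{X_I Y_J Z_K remaining} 𝒯'''|_{X_I Y_J Z_K}`
> as a direct sum of broken copies of `𝒯*`.

In the block calculus of `PartitionedTensors.lean` (parts `pX : X → 𝒫_X`, …, sub-tensors over sets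
of parts `partSubtensor` = `T‖_{A,B,C}`, direct sums of families `familyDirectSum`) this file PROVES
the general statement behind it.  An **assignment** of the parts to summands `j ∈ J` is a triple of
maps `fX : 𝒫_X → Option J`, `fY`, `fZ` (`none` = the part is zeroed out; `keptParts f` = the parts
kept, `assignedParts f j` = the parts of summand `j`); the tensor **respects** the assignment if every
non-zero entry `T(x,y,z)` all three of whose parts are kept has its three parts in ONE summand
(`RespectsAssignment`; VXXZ: every remaining level-1 block is compatible with / contained in a
unique remaining triple, and a non-zero level-1 triple lies inside a level-`ℓ` triple).  Then:

* `partSubtensor_kept_restrictsTo_familyDirectSum` — `T‖_{kept} ≥ ⊕_j T‖_{assigned to j}`;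
* `familyDirectSum_restrictsTo_partSubtensor_kept` — `⊕_j T‖_{assigned to j} ≥ T‖_{kept}`;

i.e. the zeroed-out tensor IS, up to the relabelling that separates the summands' variables, the
direct sum of the summand sub-tensors (both restrictions are `0/1` matrices: the separation of the
copies, resp. the sum map identifying them).  `partSubtensor_kept_apply_eq_sum` is the entrywise
form "`T‖_{kept} = ∑_j T‖_{assigned to j}`" (the sum IS direct).  Everything is proved; two
definitions (`keptParts`, `assignedParts`, abbreviations of filters) and one predicate.

## References

* V. Vassilevska Williams, Y. Xu, Z. Xu, R. Zhou, *New bounds for matrix multiplication: from alpha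
  to omega*, SODA 2024, arXiv:2307.07970 (held: `paper:arxiv-2307.07970`): §3.1 (independent tensors,
  direct sums), §4.2 (outline: "if all level-1 blocks in the remaining tensor are compatible with
  exactly one level-ℓ triple, then the subtensors over each remaining triple are level-1-independent"),
  §5.5 (the displayed direct-sum decomposition), §6.5. [VassilevskaWilliamsXuXuZhou2024]
* P. Bürgisser, M. Clausen, M. A. Shokrollahi, *Algebraic Complexity Theory* (1997), Prop. 15.30
  (blocks in distinct rows/columns/slices form a direct sum ≤ the tensor). [BurgisserClausenShokrollahi1997]
-/

open scoped BigOperators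
open Finset

namespace Literature.Computability.AlgebraicComplexity

universe u

variable {K : Type u} [CommSemiring K]

/-! ## Assignments of parts to summands -/

section Assignment

variable {P J : Type*} [Fintype P]

/-- The parts kept by an assignment `f : 𝒫 → Option J` (those not zeroed out). [cite: VassilevskaWilliamsXuXuZhou2024, §5.5 (remaining blocks)] -/
def keptParts (f : P → Option J) : Finset P := univ.filter fun p => f p ≠ none

/-- Membership in the kept parts. [folklore] -/
@[simp] theorem mem_keptParts {f : P → Option J} {p : P} : p ∈ keptParts f ↔ f p ≠ none := by
  simp [keptParts]

/-- A part is kept iff it is assigned to some summand. [folklore] -/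
theorem mem_keptParts_iff_exists {f : P → Option J} {p : P} : p ∈ keptParts f ↔ ∃ j, f p = some j := by
  rw [mem_keptParts, Option.ne_none_iff_exists']

variable [DecidableEq J]

/-- The parts assigned to the summand `j`. [cite: VassilevskaWilliamsXuXuZhou2024, §5.5 (the blocks of one remaining triple)] -/
def assignedParts (f : P → Option J) (j : J) : Finset P := univ.filter fun p => f p = some j

/-- Membership in the parts of a summand. [folklore] -/
@[simp] theorem mem_assignedParts {f : P → Option J} {j : J} {p : P} :
    p ∈ assignedParts f j ↔ f p = some j := by
  simp [assignedParts]

/-- The parts of distinct summands are disjoint ("they do not share the same level-1 blocks").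
[cite: VassilevskaWilliamsXuXuZhou2024, §5.5] -/
theorem disjoint_assignedParts (f : P → Option J) {j j' : J} (h : j ≠ j') :
    Disjoint (assignedParts f j) (assignedParts f j') := by
  rw [Finset.disjoint_left]
  intro p hp hp'
  rw [mem_assignedParts] at hp hp'
  exact h (Option.some_injective _ (hp.symm.trans hp'))

end Assignment

/-! ## Tensors respecting an assignment are direct sums -/

section DirectSum

variable {X Y Z PX PY PZ J : Type*} [Fintype X] [Fintype Y] [Fintype Z] [DecidableEq X]
  [DecidableEq Y] [DecidableEq Z] [Fintype PX] [Fintype PY] [Fintype PZ] [DecidableEq PX]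
  [DecidableEq PY] [DecidableEq PZ] [Fintype J] [DecidableEq J]
variable (pX : X → PX) (pY : Y → PY) (pZ : Z → PZ)

/-- **The tensor respects the assignment**: a non-zero entry all three of whose parts are assigned
has them assigned to ONE summand (VXXZ §5.5: a non-zero level-1 triple `X_Î Y_Ĵ Z_K̂` of the remaining
tensor lies in a remaining level-`ℓ` triple `X_I Y_J Z_K`, which is THE triple of each of its three
blocks). [cite: VassilevskaWilliamsXuXuZhou2024, §5.5 (level-1-independence)] -/
def RespectsAssignment (T : X → Y → Z → K) (fX : PX → Option J) (fY : PY → Option J)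
    (fZ : PZ → Option J) : Prop :=
  ∀ x y z jx jy jz, T x y z ≠ 0 → fX (pX x) = some jx → fY (pY y) = some jy → fZ (pZ z) = some jz →
    jx = jy ∧ jy = jz

variable {pX pY pZ}

omit [Fintype X] [Fintype Y] [Fintype Z] [DecidableEq X] [DecidableEq Y] [DecidableEq Z] in
/-- **Entrywise, the kept tensor is the sum of the summand sub-tensors** (and at most one summand is
non-zero at each entry): `T‖_{kept}(x,y,z) = ∑_j T‖_{assigned to j}(x,y,z)`.
[cite: VassilevskaWilliamsXuXuZhou2024, §3.1 ("their sum is the same as their direct sum") and §5.5] -/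
theorem partSubtensor_kept_apply_eq_sum (T : X → Y → Z → K) {fX : PX → Option J} {fY : PY → Option J}
    {fZ : PZ → Option J} (hT : RespectsAssignment pX pY pZ T fX fY fZ) (x : X) (y : Y) (z : Z) :
    partSubtensor pX pY pZ T (keptParts fX) (keptParts fY) (keptParts fZ) x y z =
      ∑ j, partSubtensor pX pY pZ T (assignedParts fX j) (assignedParts fY j) (assignedParts fZ j) x y z := by
  simp only [partSubtensor_apply, mem_keptParts_iff_exists, mem_assignedParts]
  by_cases hz : T x y z = 0
  · simp [hz]
  by_cases hx : ∃ j, fX (pX x) = some j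
  · obtain ⟨jx, hjx⟩ := hx
    by_cases hy : ∃ j, fY (pY y) = some j
    · obtain ⟨jy, hjy⟩ := hy
      by_cases hzz : ∃ j, fZ (pZ z) = some j
      · obtain ⟨jz, hjz⟩ := hzz
        obtain ⟨rfl, rfl⟩ := hT x y z jx jy jz hz hjx hjy hjz
        rw [if_pos ⟨⟨jx, hjx⟩, ⟨jx, hjy⟩, ⟨jx, hjz⟩⟩, Finset.sum_eq_single jx]
        · rw [if_pos ⟨hjx, hjy, hjz⟩]
        · intro j _ hj
          rw [if_neg]
          rintro ⟨h, -, -⟩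
          exact hj (Option.some_injective _ (h.symm.trans hjx))
        · simp
      · rw [if_neg fun h => hzz h.2.2]
        symm
        refine sum_eq_zero fun j _ => ?_
        rw [if_neg]
        rintro ⟨-, -, h⟩
        exact hzz ⟨j, h⟩
    · rw [if_neg fun h => hy h.2.1]
      symm
      refine sum_eq_zero fun j _ => ?_
      rw [if_neg]
      rintro ⟨-, h, -⟩
      exact hy ⟨j, h⟩
  · rw [if_neg fun h => hx h.1]
    symm
    refine sum_eq_zero fun j _ => ?_
    rw [if_neg]
    rintro ⟨h, -, -⟩
    exact hx ⟨j, h⟩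

omit [Fintype J] in
/-- **`T‖_{kept} ≥ ⊕_j T‖_{assigned to j}`**: separating the summands' variables into disjoint copies
is a restriction (`0/1` matrices sending the copy `(j, x)` to `x` when the part of `x` is assigned to
`j`; off-diagonal blocks of the result vanish because the tensor respects the assignment).
[cite: VassilevskaWilliamsXuXuZhou2024, §5.5 (𝒯''' = ⊕ 𝒯'''|_{X_I Y_J Z_K})] -/
theorem partSubtensor_kept_restrictsTo_familyDirectSum (T : X → Y → Z → K) {fX : PX → Option J}
    {fY : PY → Option J} {fZ : PZ → Option J} (hT : RespectsAssignment pX pY pZ T fX fY fZ) :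
    TensorRestrictsTo (partSubtensor pX pY pZ T (keptParts fX) (keptParts fY) (keptParts fZ))
      (familyDirectSum fun j =>
        partSubtensor pX pY pZ T (assignedParts fX j) (assignedParts fY j) (assignedParts fZ j)) := by
  refine ⟨fun a x => if x = a.2 ∧ fX (pX x) = some a.1 then 1 else 0,
    fun b y => if y = b.2 ∧ fY (pY y) = some b.1 then 1 else 0,
    fun c z => if z = c.2 ∧ fZ (pZ z) = some c.1 then 1 else 0, fun a b c => ?_⟩
  rw [Finset.sum_eq_single a.2 (fun x _ hx => by simp [hx]) (by simp),
    Finset.sum_eq_single b.2 (fun y _ hy => by simp [hy]) (by simp),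
    Finset.sum_eq_single c.2 (fun z _ hz => by simp [hz]) (by simp)]
  have hprod : ∀ (P Q R : Prop) [Decidable P] [Decidable Q] [Decidable R] (v : K),
      (if P then (1 : K) else 0) * (if Q then 1 else 0) * (if R then 1 else 0) * v =
        if P ∧ Q ∧ R then v else 0 := by
    intro P Q R _ _ _ v
    by_cases hP : P <;> by_cases hQ : Q <;> by_cases hR : R <;> simp [hP, hQ, hR]
  simp only [true_and]
  rw [hprod]
  have L : familyDirectSum (fun j => partSubtensor pX pY pZ T (assignedParts fX j) (assignedParts fY j)
      (assignedParts fZ j)) a b c =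
      if (a.1 = b.1 ∧ b.1 = c.1) ∧ (fX (pX a.2) = some a.1 ∧ fY (pY b.2) = some a.1 ∧
        fZ (pZ c.2) = some a.1) then T a.2 b.2 c.2 else 0 := by
    rw [familyDirectSum_apply, partSubtensor_apply]
    simp only [mem_assignedParts]
    by_cases hj : a.1 = b.1 ∧ b.1 = c.1
    · rw [if_pos hj]
      by_cases h2 : fX (pX a.2) = some a.1 ∧ fY (pY b.2) = some a.1 ∧ fZ (pZ c.2) = some a.1
      · rw [if_pos h2, if_pos ⟨hj, h2⟩]
      · rw [if_neg h2, if_neg fun h => h2 h.2]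
    · rw [if_neg hj, if_neg fun h => hj h.1]
  have R : (if fX (pX a.2) = some a.1 ∧ fY (pY b.2) = some b.1 ∧ fZ (pZ c.2) = some c.1 then
      partSubtensor pX pY pZ T (keptParts fX) (keptParts fY) (keptParts fZ) a.2 b.2 c.2 else 0) =
      if fX (pX a.2) = some a.1 ∧ fY (pY b.2) = some b.1 ∧ fZ (pZ c.2) = some c.1 then
        T a.2 b.2 c.2 else 0 := by
    by_cases h : fX (pX a.2) = some a.1 ∧ fY (pY b.2) = some b.1 ∧ fZ (pZ c.2) = some c.1
    · rw [if_pos h, if_pos h, partSubtensor_apply, if_pos]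
      simp only [mem_keptParts_iff_exists]
      exact ⟨⟨_, h.1⟩, ⟨_, h.2.1⟩, ⟨_, h.2.2⟩⟩
    · rw [if_neg h, if_neg h]
  rw [L, R]
  by_cases hT0 : T a.2 b.2 c.2 = 0
  · simp [hT0]
  · refine if_congr ⟨?_, ?_⟩ rfl rfl
    · rintro ⟨⟨h1, h2⟩, ha, hb, hc⟩
      refine ⟨ha, ?_, ?_⟩
      · rw [← h1]; exact hb
      · rw [← h2, ← h1]; exact hc
    · rintro ⟨ha, hb, hc⟩
      obtain ⟨h1, h2⟩ := hT a.2 b.2 c.2 a.1 b.1 c.1 hT0 ha hb hc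
      refine ⟨⟨h1, h2⟩, ha, ?_, ?_⟩
      · rw [h1]; exact hb
      · rw [h1, h2]; exact hc

/-- **`⊕_j T‖_{assigned to j} ≥ T‖_{kept}`**: the sum map identifying the copies of the variables
is a restriction, and the sum of the summand sub-tensors is the kept tensor
(`partSubtensor_kept_apply_eq_sum`).  Together with the previous theorem: the two are isomorphic.
[cite: VassilevskaWilliamsXuXuZhou2024, §3.1 and §5.5] -/
theorem familyDirectSum_restrictsTo_partSubtensor_kept (T : X → Y → Z → K) {fX : PX → Option J}
    {fY : PY → Option J} {fZ : PZ → Option J} (hT : RespectsAssignment pX pY pZ T fX fY fZ) :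
    TensorRestrictsTo
      (familyDirectSum fun j =>
        partSubtensor pX pY pZ T (assignedParts fX j) (assignedParts fY j) (assignedParts fZ j))
      (partSubtensor pX pY pZ T (keptParts fX) (keptParts fY) (keptParts fZ)) := by
  have h := familyDirectSum_le_sum_blocks
    (fun j => partSubtensor pX pY pZ T (assignedParts fX j) (assignedParts fY j) (assignedParts fZ j))
    (fun _ (x'' : X) x => if x'' = x then (1 : K) else 0) (fun _ (y'' : Y) y => if y'' = y then (1 : K) else 0)
    (fun _ (z'' : Z) z => if z'' = z then (1 : K) else 0)
  have key : (fun x'' y'' z'' => ∑ j, ∑ x, ∑ y, ∑ z,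
      (if x'' = x then (1 : K) else 0) * (if y'' = y then (1 : K) else 0) * (if z'' = z then (1 : K) else 0) *
        partSubtensor pX pY pZ T (assignedParts fX j) (assignedParts fY j) (assignedParts fZ j) x y z) =
      partSubtensor pX pY pZ T (keptParts fX) (keptParts fY) (keptParts fZ) := by
    funext x'' y'' z''
    rw [partSubtensor_kept_apply_eq_sum T hT]
    refine sum_congr rfl fun j _ => ?_
    rw [Finset.sum_eq_single x'' (fun x _ hx => by simp [Ne.symm hx]) (by simp),
      Finset.sum_eq_single y'' (fun y _ hy => by simp [Ne.symm hy]) (by simp),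
      Finset.sum_eq_single z'' (fun z _ hz => by simp [Ne.symm hz]) (by simp)]
    simp
  rw [key] at h
  exact h

end DirectSum

end Literature.Computability.AlgebraicComplexity
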